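import Mathlib
import HarnessLib

/-!
# Crux `MayerPairing.BranchPairing` (stmt-RiemannHypothesis-1471), line `weinstein-aronszajn-pinning`:
the local patch around a branching point (helper of STUB 2b `finiteSetSelection_main`)

Route `RiemannHypothesis/MayerPairing`, crux `BranchPairing` (item stmt-RiemannHypothesis-1471), line
`weinstein-aronszajn-pinning`; supports 1471. Second of three files proving the registered sub-goal
`finiteSetSelection_main` (T. Kato, *Perturbation theory for linear operators* (1966), II-§5.2
Thm. 5.2, in set form: a continuous selection of a finite-set-valued map over a real interval);
this file is the induction step "localised" and proves the registered helper sub-goal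
`finiteSetSelectionPatch_main`.

Setting: `S : ℝ → Set ℂ` over `[a, b]` with at most `n + 1` points, closed bounded graph and the
lower semicontinuity hypothesis of `finiteSetSelection_main`. Results:

* `exists_forall_dist_lt_of_isClosed_graph` — upper semicontinuity from the compact graph;
* `exists_patch_of_nontrivial` — around `τ₀` with `S τ₀` of `≥ 2` points at mutual distance
  `≥ 4ε`: a patch on which `S τ` stays within `ε` of `S τ₀` and meets every such `ε`-ball;
* `exists_finset_inter_closedBall`, `isClosed_graph_inter_closedBall`, `lsc_inter_closedBall` —
  on the patch each cluster `S τ ∩ closedBall p (2ε)`, `p ∈ S τ₀`, again satisfies the hypotheses,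
  with at most `n` points;
* `finiteSetSelectionPatch_main` — hence, GIVEN the theorem for the bound `n` (an explicit
  hypothesis: the induction hypothesis of the main proof), the clamped map
  `σ ↦ S (projIcc a b σ)` has the patch property at every `σ₀` where it has `≥ 2` points: through
  every point of its graph over `[σ₀ - η, σ₀ + η]` passes a continuous selection on that patch.

No operator theory, no `ζ`: elementary real analysis only.
-/

open Set Filter Topology Metric

namespace Summit.RiemannHypothesis.RiemannHypothesis.Theorems.MayerPairingPinning

/-! ### Upper semicontinuity and the patch -/

/-- **Upper semicontinuity from a compact graph.** If the graph of `S` over `[a, b]` is closed and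
bounded, then for every `σ₀` and `ε > 0`, for `σ ∈ [a, b]` close to `σ₀` every point of `S σ` is
within `ε` of a point of `S σ₀` (the part of the compact graph at distance `≥ ε` from `S σ₀` has
compact, hence closed, projection, which misses `σ₀`). [folklore] -/
theorem exists_forall_dist_lt_of_isClosed_graph {S : ℝ → Set ℂ} {a b : ℝ}
    (hK : IsClosed {p : ℝ × ℂ | p.1 ∈ Icc a b ∧ p.2 ∈ S p.1})
    (hB : ∃ R : ℝ, ∀ σ ∈ Icc a b, ∀ μ ∈ S σ, ‖μ‖ ≤ R) (σ₀ : ℝ) {ε : ℝ} (hε : 0 < ε) :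
    ∃ δ > (0 : ℝ), ∀ σ ∈ Icc a b, |σ - σ₀| < δ → ∀ μ ∈ S σ, ∃ μ' ∈ S σ₀, dist μ μ' < ε := by
  obtain ⟨R, hR⟩ := hB
  set K : Set (ℝ × ℂ) := {p : ℝ × ℂ | p.1 ∈ Icc a b ∧ p.2 ∈ S p.1} ∩
    {p | ∀ μ' ∈ S σ₀, ε ≤ dist p.2 μ'} with hKdef
  have hKc : IsClosed K := by
    refine hK.inter ?_
    have : {p : ℝ × ℂ | ∀ μ' ∈ S σ₀, ε ≤ dist p.2 μ'} =
        ⋂ μ' ∈ S σ₀, {p : ℝ × ℂ | ε ≤ dist p.2 μ'} := by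
      ext p; simp only [mem_setOf_eq, mem_iInter]
    rw [this]
    exact isClosed_biInter fun μ' _ =>
      isClosed_le continuous_const (continuous_snd.dist continuous_const)
  have hKb : Bornology.IsBounded K := by
    refine ((Metric.isBounded_Icc a b).prod (isBounded_closedBall (x := (0 : ℂ)) (r := R))).subset
      ?_
    rintro ⟨σ, μ⟩ ⟨⟨hσ, hμ⟩, -⟩
    exact ⟨hσ, mem_closedBall_zero_iff.2 (hR σ hσ μ hμ)⟩
  have himc : IsClosed (Prod.fst '' K) :=
    ((Metric.isCompact_of_isClosed_isBounded hKc hKb).image continuous_fst).isClosed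
  have hσ₀ : σ₀ ∉ Prod.fst '' K := by
    rintro ⟨⟨σ, μ⟩, ⟨⟨-, hμ⟩, hfar⟩, hσ⟩
    dsimp only at hμ hfar hσ
    subst hσ
    have h := hfar μ hμ
    rw [dist_self] at h
    linarith
  obtain ⟨δ, hδ, hball⟩ := Metric.isOpen_iff.1 himc.isOpen_compl σ₀ hσ₀
  refine ⟨δ, hδ, fun σ hσ hσδ μ hμ => ?_⟩
  by_contra hcon
  exact hball (mem_ball.2 (by rwa [Real.dist_eq]))
    ⟨(σ, μ), ⟨⟨hσ, hμ⟩, fun μ' hμ' => not_lt.1 fun hlt => hcon ⟨μ', hμ', hlt⟩⟩, rfl⟩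

/-- **The patch around a branching point.** At `τ₀ ∈ [a, b]` where `S τ₀` is finite with at least
two points, let `4ε` be their minimal distance; by upper and lower semicontinuity there is `η > 0`
such that for `τ ∈ [a, b]` with `|τ - τ₀| ≤ η` the set `S τ` lies within `ε` of `S τ₀` and meets
the `ε`-ball of every point of `S τ₀`. [folklore] -/
theorem exists_patch_of_nontrivial {S : ℝ → Set ℂ} {a b : ℝ}
    (hU : ∀ σ₀, ∀ ε > (0 : ℝ), ∃ δ > (0 : ℝ), ∀ σ ∈ Icc a b, |σ - σ₀| < δ →
      ∀ μ ∈ S σ, ∃ μ' ∈ S σ₀, dist μ μ' < ε)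
    (hL : ∀ σ₀ ∈ Icc a b, ∀ μ₀ ∈ S σ₀, ∀ ε > (0 : ℝ), ∃ η > (0 : ℝ), ∀ σ ∈ Icc a b,
      |σ - σ₀| < η → ∃ μ ∈ S σ, ‖μ - μ₀‖ < ε)
    {τ₀ : ℝ} (hτ₀ : τ₀ ∈ Icc a b) (hfin : (S τ₀).Finite) (hnt : (S τ₀).Nontrivial) :
    ∃ ε > (0 : ℝ), ∃ η > (0 : ℝ),
      (∀ p ∈ S τ₀, ∀ q ∈ S τ₀, p ≠ q → 4 * ε ≤ dist p q) ∧
      ∀ τ ∈ Icc a b, |τ - τ₀| ≤ η → (∀ μ ∈ S τ, ∃ p ∈ S τ₀, dist μ p < ε) ∧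
        ∀ p ∈ S τ₀, ∃ μ ∈ S τ, dist μ p < ε := by
  set ε := (S τ₀).infsep / 4 with hε
  have hε0 : 0 < ε := by
    have := hfin.infsep_pos_iff_nontrivial.2 hnt
    positivity
  have hsep : ∀ p ∈ S τ₀, ∀ q ∈ S τ₀, p ≠ q → 4 * ε ≤ dist p q := fun p hp q hq hpq => by
    have : (S τ₀).infsep ≤ dist p q := le_edist_of_le_infsep hp hq hpq le_rfl
    linarith
  obtain ⟨δ₁, hδ₁, hcov⟩ := hU τ₀ ε hε0
  have hmeet : ∀ᶠ τ in 𝓝[Icc a b] τ₀, ∀ p ∈ S τ₀, ∃ μ ∈ S τ, dist μ p < ε := by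
    refine hfin.eventually_all.2 fun p hp => ?_
    obtain ⟨η, hη, h⟩ := hL τ₀ hτ₀ p hp ε hε0
    rw [eventually_nhdsWithin_iff, Metric.eventually_nhds_iff]
    refine ⟨η, hη, fun τ hτ hτab => ?_⟩
    obtain ⟨μ, hμ, hμ'⟩ := h τ hτab (by rwa [← Real.dist_eq])
    exact ⟨μ, hμ, by rwa [dist_eq_norm]⟩
  rw [eventually_nhdsWithin_iff, Metric.eventually_nhds_iff] at hmeet
  obtain ⟨δ₂, hδ₂, hmeet⟩ := hmeet
  refine ⟨ε, hε0, min δ₁ δ₂ / 2, by positivity, hsep, fun τ hτ hττ₀ => ⟨?_, ?_⟩⟩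
  · exact hcov τ hτ (by linarith [min_le_left δ₁ δ₂])
  · exact hmeet (show dist τ τ₀ < δ₂ by rw [Real.dist_eq]; linarith [min_le_right δ₁ δ₂]) hτ

/-- **Cardinality drops on a patch.** On the patch, the part of `S τ` in the closed `2ε`-ball
around one point `p ∈ S τ₀` misses the points of `S τ` near any other point of `S τ₀`, so it has
at most `n` points when `S τ` has at most `n + 1`. [folklore] -/
theorem exists_finset_inter_closedBall {S : ℝ → Set ℂ} {n : ℕ} {τ τ₀ ε : ℝ} {p : ℂ}
    (hF : ∃ F : Finset ℂ, (↑F : Set ℂ) = S τ ∧ F.card ≤ n + 1)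
    (hsep : ∀ p ∈ S τ₀, ∀ q ∈ S τ₀, p ≠ q → 4 * ε ≤ dist p q)
    (hmeet : ∀ q ∈ S τ₀, ∃ μ ∈ S τ, dist μ q < ε)
    (hp : p ∈ S τ₀) (hnt : (S τ₀).Nontrivial) :
    ∃ F : Finset ℂ, (↑F : Set ℂ) = S τ ∩ closedBall p (2 * ε) ∧ F.card ≤ n := by
  classical
  obtain ⟨F, hFS, hFcard⟩ := hF
  obtain ⟨q, hq, hqp⟩ := hnt.exists_ne p
  obtain ⟨μq, hμq, hμqq⟩ := hmeet q hq
  have hfar : μq ∉ closedBall p (2 * ε) := fun h => by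
    have h4 := hsep p hp q hq hqp.symm
    rw [mem_closedBall, dist_comm] at h
    linarith [dist_triangle p μq q, dist_nonneg (x := μq) (y := q)]
  refine ⟨F.filter fun μ => μ ∈ closedBall p (2 * ε), ?_, ?_⟩
  · ext μ
    simp only [Finset.coe_filter, mem_setOf_eq, mem_inter_iff, ← hFS, Finset.mem_coe]
  · have hss : (F.filter fun μ => μ ∈ closedBall p (2 * ε)) ⊂ F :=
      Finset.filter_ssubset.2 ⟨μq, by rw [← Finset.mem_coe, hFS]; exact hμq, hfar⟩
    have := Finset.card_lt_card hss
    omega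

/-- **Closed graph on a patch.** The graph of `σ ↦ S σ ∩ closedBall p r` over a subinterval
`[a', b'] ⊆ [a, b]` is closed when the graph of `S` over `[a, b]` is. [folklore] -/
theorem isClosed_graph_inter_closedBall {S : ℝ → Set ℂ} {a b a' b' : ℝ}
    (hK : IsClosed {p : ℝ × ℂ | p.1 ∈ Icc a b ∧ p.2 ∈ S p.1}) (hsub : Icc a' b' ⊆ Icc a b)
    (p : ℂ) (r : ℝ) :
    IsClosed {x : ℝ × ℂ | x.1 ∈ Icc a' b' ∧ x.2 ∈ S x.1 ∩ closedBall p r} := by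
  have : {x : ℝ × ℂ | x.1 ∈ Icc a' b' ∧ x.2 ∈ S x.1 ∩ closedBall p r} =
      {x : ℝ × ℂ | x.1 ∈ Icc a b ∧ x.2 ∈ S x.1} ∩
        (Prod.fst ⁻¹' Icc a' b' ∩ Prod.snd ⁻¹' closedBall p r) := by
    ext x
    simp only [mem_setOf_eq, mem_inter_iff, mem_preimage]
    constructor
    · rintro ⟨h1, h2, h3⟩; exact ⟨⟨hsub h1, h2⟩, h1, h3⟩
    · rintro ⟨⟨-, h2⟩, h1, h3⟩; exact ⟨h1, h2, h3⟩
  rw [this]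
  exact hK.inter ((isClosed_Icc.preimage continuous_fst).inter
    (isClosed_closedBall.preimage continuous_snd))

/-- **Lower semicontinuity on a patch.** On a patch where `S τ` stays within `ε` of `S τ₀` (whose
points are `4ε`-separated), the part of `S` in the closed `2ε`-ball around `p ∈ S τ₀` inherits
the lower semicontinuity of `S`. [folklore] -/
theorem lsc_inter_closedBall {S : ℝ → Set ℂ} {a b a' b' τ₀ ε : ℝ} {p : ℂ}
    (hL : ∀ σ₀ ∈ Icc a b, ∀ μ₀ ∈ S σ₀, ∀ ε > (0 : ℝ), ∃ η > (0 : ℝ), ∀ σ ∈ Icc a b,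
      |σ - σ₀| < η → ∃ μ ∈ S σ, ‖μ - μ₀‖ < ε)
    (hsub : Icc a' b' ⊆ Icc a b) (hsep : ∀ p ∈ S τ₀, ∀ q ∈ S τ₀, p ≠ q → 4 * ε ≤ dist p q)
    (hcov : ∀ τ ∈ Icc a' b', ∀ μ ∈ S τ, ∃ q ∈ S τ₀, dist μ q < ε) (hp : p ∈ S τ₀) :
    ∀ σ₀ ∈ Icc a' b', ∀ μ₀ ∈ S σ₀ ∩ closedBall p (2 * ε), ∀ ε' > (0 : ℝ), ∃ η > (0 : ℝ),
      ∀ σ ∈ Icc a' b', |σ - σ₀| < η → ∃ μ ∈ S σ ∩ closedBall p (2 * ε), ‖μ - μ₀‖ < ε' := by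
  intro σ₀ hσ₀ μ₀ hμ₀ ε' hε'
  have hμ₀p : dist μ₀ p < ε := by
    obtain ⟨q, hq, hμ₀q⟩ := hcov σ₀ hσ₀ μ₀ hμ₀.1
    by_cases hqp : q = p
    · rwa [hqp] at hμ₀q
    · have h4 := hsep q hq p hp hqp
      have h2 : dist μ₀ p ≤ 2 * ε := hμ₀.2
      rw [dist_comm] at hμ₀q
      linarith [dist_triangle q μ₀ p, dist_nonneg (x := q) (y := μ₀)]
  obtain ⟨η, hη, h⟩ := hL σ₀ (hsub hσ₀) μ₀ hμ₀.1 (min ε' (ε - dist μ₀ p))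
    (lt_min hε' (sub_pos.2 hμ₀p))
  refine ⟨η, hη, fun σ hσ hσσ₀ => ?_⟩
  obtain ⟨μ, hμ, hμμ₀⟩ := h σ (hsub hσ) hσσ₀
  refine ⟨μ, ⟨hμ, ?_⟩, hμμ₀.trans_le (min_le_left _ _)⟩
  have : dist μ μ₀ < ε - dist μ₀ p := by
    rw [dist_eq_norm]; exact hμμ₀.trans_le (min_le_right _ _)
  rw [mem_closedBall]
  linarith [dist_triangle μ μ₀ p, dist_nonneg (x := μ₀) (y := p)]

/-! ### The patch property of the clamped map -/

/-- **The patch property** (registered helper sub-goal `finiteSetSelectionPatch_main` of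
stmt-RiemannHypothesis-1471; the induction step of `finiteSetSelection_main`, localised). Assume
the selection theorem for set-valued maps with at most `n` points (first hypothesis), and let `S`
over `[a, b]` have at most `n + 1` points, closed bounded graph and the lower semicontinuity
property. Then at every `σ₀` where the clamped map `σ ↦ S (projIcc a b σ)` has `≥ 2` points there
is `η > 0` such that through every point of its graph over `[σ₀ - η, σ₀ + η]` passes a continuous
selection on `[σ₀ - η, σ₀ + η]`: on the patch of `exists_patch_of_nontrivial` around
`τ₀ = projIcc a b σ₀` the values split into the clusters `S ∩ closedBall p (2ε)`, `p ∈ S τ₀`, each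
with `≤ n` points and all hypotheses, so the assumed theorem selects inside the cluster of the
given point, and the selection is clamped back (Kato 1966, II-§5.2, proof of Thm. 5.2). -/
theorem finiteSetSelectionPatch_main : ∀ (n : ℕ) (S : ℝ → Set ℂ) (a b : ℝ) (hab : a ≤ b), (∀ (S' : ℝ → Set ℂ) (a' b' : ℝ), a' ≤ b' → (∀ σ ∈ Set.Icc a' b', (S' σ).Nonempty) → (∀ σ ∈ Set.Icc a' b', ∃ F : Finset ℂ, (↑F : Set ℂ) = S' σ ∧ F.card ≤ n) → IsClosed {p : ℝ × ℂ | p.1 ∈ Set.Icc a' b' ∧ p.2 ∈ S' p.1} → (∃ R : ℝ, ∀ σ ∈ Set.Icc a' b', ∀ μ ∈ S' σ, ‖μ‖ ≤ R) → (∀ σ₀ ∈ Set.Icc a' b', ∀ μ₀ ∈ S' σ₀, ∀ ε > (0 : ℝ), ∃ η > (0 : ℝ), ∀ σ ∈ Set.Icc a' b', |σ - σ₀| < η → ∃ μ ∈ S' σ, ‖μ - μ₀‖ < ε) → ∀ σ₁ ∈ Set.Icc a' b', ∀ μ₁ ∈ S' σ₁, ∃ Λ : ℝ → ℂ, ContinuousOn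 Λ (Set.Icc a' b') ∧ Λ σ₁ = μ₁ ∧ ∀ σ ∈ Set.Icc a' b', Λ σ ∈ S' σ) → (∀ σ ∈ Set.Icc a b, ∃ F : Finset ℂ, (↑F : Set ℂ) = S σ ∧ F.card ≤ n + 1) → IsClosed {p : ℝ × ℂ | p.1 ∈ Set.Icc a b ∧ p.2 ∈ S p.1} → (∃ R : ℝ, ∀ σ ∈ Set.Icc a b, ∀ μ ∈ S σ, ‖μ‖ ≤ R) → (∀ σ₀ ∈ Set.Icc a b, ∀ μ₀ ∈ S σ₀, ∀ ε > (0 : ℝ), ∃ η > (0 : ℝ), ∀ σ ∈ Set.Icc a b, |σ - σ₀| < η → ∃ μ ∈ S σ, ‖μ - μ₀‖ < ε) → ∀ σ₀ : ℝ, (S (Set.projIcc a b hab σ₀)).Nontrivial → ∃ η > (0 : ℝ), ∀ σ' ∈ Set.Icc (σ₀ - η) (σ₀ + η), ∀ μ' ∈ S (Set.projIcc a b hab σ'), ∃ Λ : ℝ → ℂ, ContinuousOn Λ (Set.Icc (σ₀ - η) (σ₀ + η)) ∧ Λ σ' = μ' ∧ ∀ σ ∈ Set.Icc (σ₀ - η)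 (σ₀ + η), Λ σ ∈ S (Set.projIcc a b hab σ) := by
  intro n S a b hab ih hC hK hB hL σ₀ hnt
  have hU : ∀ σ₀, ∀ ε > (0 : ℝ), ∃ δ > (0 : ℝ), ∀ σ ∈ Icc a b, |σ - σ₀| < δ →
      ∀ μ ∈ S σ, ∃ μ' ∈ S σ₀, dist μ μ' < ε :=
    fun σ₀ ε hε => exists_forall_dist_lt_of_isClosed_graph hK hB σ₀ hε
  set τ₀ : ℝ := (projIcc a b hab σ₀ : ℝ) with hτ₀
  have hτ₀ab : τ₀ ∈ Icc a b := (projIcc a b hab σ₀).2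
  obtain ⟨F, hF, -⟩ := hC τ₀ hτ₀ab
  have hfin : (S τ₀).Finite := hF ▸ F.finite_toSet
  obtain ⟨ε, hε, η, hη, hsep, hnear⟩ := exists_patch_of_nontrivial hU hL hτ₀ab hfin hnt
  refine ⟨η, hη, fun σ' hσ' μ' hμ' => ?_⟩
  -- the patch interval `[a', b'] ⊆ [a, b]`
  set a' := max a (τ₀ - η) with ha'
  set b' := min b (τ₀ + η) with hb'
  have hI : Icc a' b' ⊆ Icc a b := Icc_subset_Icc (le_max_left _ _) (min_le_left _ _)
  have hInear : ∀ τ ∈ Icc a' b', |τ - τ₀| ≤ η := fun τ hτ =>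
    abs_sub_le_iff.2 ⟨by linarith [min_le_right b (τ₀ + η), hτ.2],
      by linarith [le_max_right a (τ₀ - η), hτ.1]⟩
  have hPI : ∀ σ ∈ Icc (σ₀ - η) (σ₀ + η), (projIcc a b hab σ : ℝ) ∈ Icc a' b' := by
    intro σ hσ
    have h1 : |(projIcc a b hab σ : ℝ) - τ₀| ≤ η :=
      (abs_projIcc_sub_projIcc hab).trans (abs_sub_le_iff.2 ⟨by linarith [hσ.2],
        by linarith [hσ.1]⟩)
    have h2 := (projIcc a b hab σ).2
    exact ⟨max_le h2.1 (by linarith [(abs_sub_le_iff.1 h1).2]),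
      le_min h2.2 (by linarith [(abs_sub_le_iff.1 h1).1])⟩
  have hσ₀I := hPI σ₀ ⟨by linarith, by linarith⟩
  have ha'b' : a' ≤ b' := hσ₀I.1.trans hσ₀I.2
  have hτ'I := hPI σ' hσ'
  obtain ⟨p, hp, hμ'p⟩ := (hnear _ (hI hτ'I) (hInear _ hτ'I)).1 μ' hμ'
  -- the assumed theorem for the cluster of `p` over `[a', b']`
  obtain ⟨Λ, hΛc, hΛv, hΛS⟩ := ih (fun σ => S σ ∩ closedBall p (2 * ε)) a' b' ha'b'
    (fun σ hσ => by
      obtain ⟨μ, hμ, hμp⟩ := (hnear σ (hI hσ) (hInear σ hσ)).2 p hp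
      exact ⟨μ, hμ, mem_closedBall.2 (by linarith)⟩)
    (fun σ hσ => exists_finset_inter_closedBall (hC σ (hI hσ)) hsep
      (hnear σ (hI hσ) (hInear σ hσ)).2 hp hnt)
    (isClosed_graph_inter_closedBall hK hI p (2 * ε))
    (by obtain ⟨R, hR⟩ := hB; exact ⟨R, fun σ hσ μ hμ => hR σ (hI hσ) μ hμ.1⟩)
    (lsc_inter_closedBall hL hI hsep (fun τ hτ => (hnear τ (hI hτ) (hInear τ hτ)).1) hp)
    _ hτ'I μ' ⟨hμ', mem_closedBall.2 (by linarith)⟩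
  refine ⟨fun σ => Λ (projIcc a b hab σ), ?_, hΛv, fun σ hσ => (hΛS _ (hPI σ hσ)).1⟩
  exact hΛc.comp (continuous_subtype_val.comp continuous_projIcc).continuousOn
    fun σ hσ => hPI σ hσ

end Summit.RiemannHypothesis.RiemannHypothesis.Theorems.MayerPairingPinning
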